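import Literature.Probability.Percolation.ConstrainedClusters
import Literature.Probability.Percolation.SubgraphMonotonicity
import Literature.Probability.Percolation.CriticalContinuity
import HarnessLib

/-!
# The open rungs left by seat `solo-CriticalPhenomena-blind` (sharpest open statements, as conjecture nodes)

Everything strictly below (a)/(b) on the co-wedge / pore ladders is proved in the tree:
`Theorems/SoloBlindSparseFins`, `SoloBlindSquareFin` (fins with gaps `≫ log`), `SoloBlindGapFinsOwn`,
`SoloBlindPerforatedWalls` (Borel–Cantelli-sparse pores), and the ladders themselves in
`Literature.Probability.Percolation.ContinuityZ3Ladder` (the summit is (b) with a co-singleton pore set,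
`percolationContinuityZ3_iff_poreRegion_cosingleton`; (a) is `fin_rung`'s hypothesis).  The three conjecture
Props below are NOT asserted; the two theorems record that (a) and (b) lie below the summit.

* (a) `FinRung` — the fully attached fin `{0 ≤ x₀ ∨ x₁ = 0}`: open (bounded gaps; a logarithm away from
  `SoloBlindSquareFin.theta_induce_sparseFin_criticalProbI_eq_zero_of_gaps`).
* (b) `PeriodicPores` — the periodically perforated plane, some period `k ≥ 2`: open (beyond first moments:
  `χ₁₁(p_c) = ∞`).
* (c) `LineRate` — summability of the critical half-space two-point function along a boundary line
  (numerically `τ ≈ n^{-1.95}`); the weakest rate that would move a rung (BK chain counting).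
-/

open MeasureTheory Literature.Probability.Percolation Literature.Probability.LatticeModels

namespace Summit.CriticalPhenomena.PercolationContinuityZ3.Theorems.SoloBlindOpenRungs

/-- (a) FIN RUNG: the half-space with a perpendicular half-plane attached at every height does not percolate at
`p_c(ℤ³)`. Proved for attachment heights with gaps `≫ log j` (square fin); open for bounded gaps. -/
def FinRung : Prop :=
  ∀ h0, theta ((zdGraph 3).induce {x : Site 3 | 0 ≤ x 0 ∨ x 1 = 0}) ⟨0, h0⟩ (criticalProbI 3) = 0

/-- (b) PERIODICALLY PERFORATED PLANE: for some period `k ≥ 2`, `ℤ³` minus the plane `{x₀ = -1}` perforated at the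
pores `kℤ²` does not percolate at `p_c(ℤ³)`. Proved for Borel–Cantelli-sparse pore sets; `k = 1` is the summit. -/
def PeriodicPores : Prop :=
  ∃ k : ℕ, 2 ≤ k ∧ ∀ h0, theta ((zdGraph 3).induce ({x : Site 3 | 0 ≤ x 0} ∪
    {x | x 0 ≤ -2 ∨ (x 0 = -1 ∧ (k : ℤ) ∣ x 1 ∧ (k : ℤ) ∣ x 2)})) ⟨0, h0⟩ (criticalProbI 3) = 0

/-- (c) THE RATE ("2x_s > 1"): the critical half-space two-point function from the origin is summable along a
boundary line. Numerically `τ ≈ n^{-1.95}`. With a constant it gives (a) by BK chain counting (claim C11). -/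
def LineRate : Prop :=
  Summable (fun z : ℤ => ((bondPercolation (zdGraph 3) (criticalProbI 3))
    (openConnVia (withinGraph (zdGraph 3) {x : Site 3 | 0 ≤ x 0}) 0 (Function.update 0 2 z))).toReal)

/-- Each rung lies BELOW the summit: `θ_{G[S]} ≤ θ_G` (`theta_induce_le_holds`). -/
theorem finRung_of_percolationContinuityZ3
    (h : Literature.Probability.Percolation.PercolationContinuityZ3) : FinRung := by
  intro h0
  refine le_antisymm ?_ ?_
  · calc theta ((zdGraph 3).induce {x : Site 3 | 0 ≤ x 0 ∨ x 1 = 0}) ⟨0, h0⟩ (criticalProbI 3)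
          ≤ theta (zdGraph 3) 0 (criticalProbI 3) := theta_induce_le_holds (zdGraph 3) _ 0 h0 _
      _ = 0 := h
  · unfold theta; exact measureReal_nonneg

/-- The periodically perforated plane (any period, here `k = 2`) lies BELOW the summit (`theta_induce_le_holds`). -/
theorem periodicPores_of_percolationContinuityZ3
    (h : Literature.Probability.Percolation.PercolationContinuityZ3) : PeriodicPores := by
  refine ⟨2, le_rfl, fun h0 => le_antisymm ?_ ?_⟩
  · calc theta ((zdGraph 3).induce ({x : Site 3 | 0 ≤ x 0} ∪
            {x | x 0 ≤ -2 ∨ (x 0 = -1 ∧ ((2 : ℕ) : ℤ) ∣ x 1 ∧ ((2 : ℕ) : ℤ) ∣ x 2)})) ⟨0, h0⟩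
            (criticalProbI 3)
          ≤ theta (zdGraph 3) 0 (criticalProbI 3) := theta_induce_le_holds (zdGraph 3) _ 0 h0 _
      _ = 0 := h
  · unfold theta; exact measureReal_nonneg

end Summit.CriticalPhenomena.PercolationContinuityZ3.Theorems.SoloBlindOpenRungs
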